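import Mathlib.AlgebraicGeometry.EllipticCurve.DivisionPolynomial.Basic
import Mathlib.AlgebraicGeometry.EllipticCurve.Jacobian.Point
import Mathlib.NumberTheory.EllipticDivisibilitySequence
import Mathlib.RingTheory.Localization.FractionRing
import Mathlib.RingTheory.MvPolynomial.Basic
import Mathlib.RingTheory.Polynomial.UniqueFactorization
import Mathlib.RingTheory.Polynomial.RationalRoot
import Literature.NumberTheory.EllipticCurves.DivisionPolynomialTorsion
import Literature.NumberTheory.EllipticCurves.EllipticNet
import HarnessLib

/-!
# Multiplication by `n` via division polynomials (Silverman, *AEC*, Exercise 3.7(d),(f))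

Topic `NumberTheory/EllipticCurves` (trunk T-ELLARITH). An unconditional proof of the
multiplication-by-`n` formula `[n]P = (φₙ(P)/ψₙ(P)², ωₙ(P)/ψₙ(P)³)` (Silverman, *AEC*,
Exercise 3.7(d)) and of "`ψₙ` vanishes precisely on `E[n] ∖ O`" (Exercise 3.7(f)) for nonsingular
points of Weierstrass curves over fields, discharging the named fact
`WeierstrassCurve.zsmul_eq_zero_iff_evalEval_ψ` of `DivisionPolynomialTorsion`
(`WeierstrassCurve.zsmul_eq_zero_iff_evalEval_ψ_holds`, at the end of this file), on which
`WeierstrassCurve.card_torsionPoints_eq_sq` (Silverman III.6.4(b), `#E[m] = m²`) and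
`WeierstrassCurve.finrank_rationalTateModule_eq_two` (III.7.1) rest. Mathlib (this pin) has the
division polynomials `ψₙ, φₙ` (`WeierstrassCurve.ψ`, `WeierstrassCurve.φ`), their degrees and their
congruences in the coordinate ring, but records the multiplication formula as a TODO; the
architecture below is J. Xu's (Mathlib pull request 13782, 2024, unmerged: "the universal elliptic
curve" and `DivisionPolynomial/ZSMul.lean`), simplified (no `ω`-invariants: `ωₙ` is obtained by
integral closedness, and the `y`-coordinate is tracked through `ψ₂(nP) = ψ₂ₙ/ψₙ⁴`).

## Contents

1. `Literature.NumberTheory.EllipticCurves.UnivEC.curve`: the *universal pointed Weierstrass curve* over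
   `U = ℤ[A₁, A₂, A₃, A₄, X, Y]` (`MvPolynomial (Fin 6) ℤ`, a UFD), with
   `A₆ := Y² + A₁XY + A₃Y − X³ − A₂X² − A₄X`, so that `(X, Y)` lies on it (`equation_xU_yU`); every
   Weierstrass curve `W/S` with a point `(x₀, y₀)` on it is `curve.map (ev W x₀ y₀)` (`curve_map_ev`).
2. `Literature.UnivEC.ψ n`, `φ n ∈ U`: the division polynomials at the universal point; `ψ n ≠ 0` for
   `n ≠ 0` (`ψ_ne_zero`: at the cusp `y² = x³`, `ψₙ(1, 1) = n`, `normEDS_two_three_two`); the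
   elliptic-net relations for `ψ` (`rel₃`, `net_add_sub`, from `Literature.NumberTheory.EllipticCurves.EllipticNet.isEllipticNet_normEDS`,
   Xu 2026 Thm 4.1, tree file `EllipticNet`).
3. Over the universal field `K = Frac(U)` (characteristic `0`) the universal point `P = (X, Y)` is
   nonsingular and **`n • P = (Xₙ, Yₙ)` for `n ≠ 0`, `Xₙ = φₙ/ψₙ²`, `2Yₙ + A₁Xₙ + A₃ = ψ₂ₙ/ψₙ⁴`**
   (`zsmul_P`): strong induction through the chord-tangent formulas — `x(2P)` from
   `addX_self_sub_mul_sq` (tree), `y(2P)` from `addY_self_sub_negY_mul_cube` (duplication formula for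
   `2y + a₁x + a₃`), `x((m+1)P)` from `x(Q + P) + x(Q − P)` (`Xn_add`, relation `E(n, m, 1)`),
   `y((m+1)P)` from Mathlib's `addY_sub_negY_addY` (`Tn_add`, net relation `E(m+n, m, m−n, n)`).
4. `Literature.UnivEC.ω n ∈ U` with `ωₙ = y(nP) ψₙ³` in `K` (`ι_ω`; integrality over the integrally closed
   `U`), the Jacobian triples `T n = (φₙ, ωₙ, ψₙ)` and the **exact identities in `U³`**
   `dblXYZ (T n) = T (2n)` (`dblXYZ_T`) and `addXYZ (T n) (T (n+1)) = T (2n+1)` (`addXYZ_T`) for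
   Mathlib's weighted-projective doubling/addition polynomials (both sides represent the same
   multiple of `P` over `K` and have the same `Z`-coordinate; `Jacobian.eq_of_toAffine_eq`).
5. Specialisation along `ev : U → F` to any nonsingular point `Q = (x₀, y₀)` of any Weierstrass
   curve `V` over a field: `(φₙ(Q), ωₙ(Q), ψₙ(Q))` is a nonsingular Jacobian representative of
   `n • Q` for `n ≥ 1` (`WeierstrassCurve.Affine.Point.nonsingular_smulTriple`, strong induction
   `2k = k + k`, `2k+1 = k + (k+1)`), hence `n • Q = O ↔ ψₙ(Q) = 0` (`zsmul_some_eq_zero_iff`,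
   Exercise 3.7(f)) and `n • Q = (φₙ(Q)/ψₙ(Q)², ωₙ(Q)/ψₙ(Q)³)` when `ψₙ(Q) ≠ 0`
   (`zsmul_some_eq_of_evalEval_ψ_ne_zero`, Exercise 3.7(d), all `n ∈ ℤ`), and the discharge
   `WeierstrassCurve.zsmul_eq_zero_iff_evalEval_ψ_holds`.

## References

* J. H. Silverman, *The Arithmetic of Elliptic Curves*, 2nd ed., GTM 106, Springer 2009: Group Law
  Algorithm III.2.3 (pp. 53–54 of the held text), Exercise 3.7 (p. 105). [SilvermanAEC2009]
* J. Xu, *Division polynomials and multiplication by `n`*, Mathlib pull request 13782 (2024), files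
  `DivisionPolynomial/ZSMul.lean`, `Universal.lean` (architecture: universal curve, `ψₙ ≠ 0` via an
  integral specialisation, strong induction with the EDS/net relations, Jacobian identities).
* J. Xu, *On Elliptic Sequences over Commutative Rings*, arXiv:2604.05280 (2026), Thm 4.1
  (`IsEllipticNet ψ`, tree file `EllipticNet`). [Xu2026]

## Design

Sections 1–4 live in `namespace Literature.UnivEC` (`U`, `K`, `ι = algebraMap U K` are `abbrev`s; `K`
carries the classical `DecidableEq` needed by Mathlib's affine group law); Section 5 consists of
deliberate dot-notation extensions in `namespace WeierstrassCurve.Affine.Point` /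
`WeierstrassCurve.Jacobian` / `WeierstrassCurve`. The universal ring is a polynomial ring in six
variables over `ℤ` (rather than the Mathlib PR's quotient of a seven-variable ring by the
Weierstrass equation), which makes `U` a UFD, hence integrally closed, for free. `ωₙ` is *defined*
by its characterisation `ι (ω n) = Yₙ ψₙ³` (choice of the unique preimage), with `ω₀ := 1`.
-/

noncomputable section

open Polynomial WeierstrassCurve
open scoped Polynomial.Bivariate WeierstrassCurve.Jacobian

namespace Literature.NumberTheory.EllipticCurves

namespace UnivEC

/-! ## The universal pointed Weierstrass curve over `U = ℤ[A₁, A₂, A₃, A₄, X, Y]` -/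

/-- The universal ring `U = ℤ[A₁, A₂, A₃, A₄, X, Y]` of pointed Weierstrass curves. [folklore] -/
abbrev U : Type := MvPolynomial (Fin 6) ℤ

/-- The coefficient `A₁` of the universal pointed curve. [folklore] -/
def A₁ : U := MvPolynomial.X 0
/-- The coefficient `A₂` of the universal pointed curve. [folklore] -/
def A₂ : U := MvPolynomial.X 1
/-- The coefficient `A₃` of the universal pointed curve. [folklore] -/
def A₃ : U := MvPolynomial.X 2
/-- The coefficient `A₄` of the universal pointed curve. [folklore] -/
def A₄ : U := MvPolynomial.X 3
/-- The `x`-coordinate of the universal point. [folklore] -/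
def xU : U := MvPolynomial.X 4
/-- The `y`-coordinate of the universal point. [folklore] -/
def yU : U := MvPolynomial.X 5
/-- The coefficient `A₆ := Y² + A₁XY + A₃Y - X³ - A₂X² - A₄X`, forced by `(X, Y)` lying on the
curve. [folklore] -/
def A₆ : U := yU ^ 2 + A₁ * xU * yU + A₃ * yU - (xU ^ 3 + A₂ * xU ^ 2 + A₄ * xU)

/-- The universal pointed Weierstrass curve `y² + A₁xy + A₃y = x³ + A₂x² + A₄x + A₆` over
`U = ℤ[A₁, A₂, A₃, A₄, X, Y]`, with `A₆` chosen so that `(X, Y)` lies on it. [folklore] -/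
def curve : WeierstrassCurve U := ⟨A₁, A₂, A₃, A₄, A₆⟩

/-- `a₁` of the universal curve is `A₁`. [folklore] -/
@[simp] lemma curve_a₁ : curve.a₁ = A₁ := rfl
/-- `a₂` of the universal curve is `A₂`. [folklore] -/
@[simp] lemma curve_a₂ : curve.a₂ = A₂ := rfl
/-- `a₃` of the universal curve is `A₃`. [folklore] -/
@[simp] lemma curve_a₃ : curve.a₃ = A₃ := rfl
/-- `a₄` of the universal curve is `A₄`. [folklore] -/
@[simp] lemma curve_a₄ : curve.a₄ = A₄ := rfl
/-- `a₆` of the universal curve is `A₆`. [folklore] -/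
@[simp] lemma curve_a₆ : curve.a₆ = A₆ := rfl

/-- The universal point lies on the universal curve. [folklore] -/
lemma equation_xU_yU : curve.toAffine.Equation xU yU := by
  rw [WeierstrassCurve.Affine.equation_iff]
  simp only [curve, A₆]
  ring

/-! ## Specialisation -/

section Specialize

variable {S : Type*} [CommRing S] (W : WeierstrassCurve S) (x₀ y₀ : S)

/-- The specialisation homomorphism `U → S` attached to a Weierstrass curve `W/S` and a pair
`(x₀, y₀)`: `Aᵢ ↦ aᵢ` (`i ≤ 4`), `X ↦ x₀`, `Y ↦ y₀`. [folklore] -/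
def ev : U →+* S :=
  MvPolynomial.eval₂Hom (Int.castRingHom S) ![W.a₁, W.a₂, W.a₃, W.a₄, x₀, y₀]

/-- The specialisation sends `A₁ ↦ a₁`. [folklore] -/
@[simp] lemma ev_A₁ : ev W x₀ y₀ A₁ = W.a₁ := by simp [ev, A₁]
/-- The specialisation sends `A₂ ↦ a₂`. [folklore] -/
@[simp] lemma ev_A₂ : ev W x₀ y₀ A₂ = W.a₂ := by simp [ev, A₂]
/-- The specialisation sends `A₃ ↦ a₃`. [folklore] -/
@[simp] lemma ev_A₃ : ev W x₀ y₀ A₃ = W.a₃ := by simp [ev, A₃]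
/-- The specialisation sends `A₄ ↦ a₄`. [folklore] -/
@[simp] lemma ev_A₄ : ev W x₀ y₀ A₄ = W.a₄ := by simp [ev, A₄]
/-- The specialisation sends `X ↦ x₀`. [folklore] -/
@[simp] lemma ev_xU : ev W x₀ y₀ xU = x₀ := by simp [ev, xU]
/-- The specialisation sends `Y ↦ y₀`. [folklore] -/
@[simp] lemma ev_yU : ev W x₀ y₀ yU = y₀ := by simp [ev, yU]

variable {W x₀ y₀}

/-- If `(x₀, y₀)` lies on `W` then `A₆ ↦ a₆`. [folklore] -/
lemma ev_A₆ (h : W.toAffine.Equation x₀ y₀) : ev W x₀ y₀ A₆ = W.a₆ := by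
  rw [WeierstrassCurve.Affine.equation_iff] at h
  simp only [A₆, map_sub, map_add, map_mul, map_pow, ev_A₁, ev_A₂, ev_A₃, ev_A₄, ev_xU, ev_yU]
  linear_combination h

/-- Every pointed Weierstrass curve is a specialisation of the universal one. [folklore] -/
lemma curve_map_ev (h : W.toAffine.Equation x₀ y₀) : curve.map (ev W x₀ y₀) = W := by
  ext <;> simp [curve, ev_A₆ h]

end Specialize

/-! ## The universal division values `ψₙ(X, Y)`, `φₙ(X, Y)` -/

/-- `ψₙ(X, Y) ∈ U`: the `n`-th division polynomial of the universal curve at the universal point.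
[folklore] -/
def ψ (n : ℤ) : U := (curve.ψ n).evalEval xU yU

/-- `φₙ(X, Y) ∈ U`. [folklore] -/
def φ (n : ℤ) : U := (curve.φ n).evalEval xU yU

/-- `ψₙ(X, Y)` is the normalised EDS on the values `ψ₂(X, Y)`, `ψ₃(X)`, `preΨ₄(X)`. [folklore] -/
lemma ψ_apply (n : ℤ) : ψ n = normEDS (curve.ψ₂.evalEval xU yU) (curve.Ψ₃.eval xU)
    (curve.preΨ₄.eval xU) n := by
  unfold ψ WeierstrassCurve.ψ
  rw [← coe_evalEvalRingHom, map_normEDS]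
  simp

/-- `ψ(X, Y) = normEDS (ψ₂(X, Y)) (ψ₃(X)) (preΨ₄(X))` as sequences. [folklore] -/
lemma ψ_eq_normEDS : ψ = normEDS (curve.ψ₂.evalEval xU yU) (curve.Ψ₃.eval xU)
    (curve.preΨ₄.eval xU) :=
  funext ψ_apply

/-- `ψ₀(X, Y) = 0`. [folklore] -/
@[simp] lemma ψ_zero : ψ 0 = 0 := by simp [ψ]
/-- `ψ₁(X, Y) = 1`. [folklore] -/
@[simp] lemma ψ_one : ψ 1 = 1 := by simp [ψ]
/-- `ψ₂(X, Y) = 2Y + A₁X + A₃`. [folklore] -/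
lemma ψ_two : ψ 2 = 2 * yU + A₁ * xU + A₃ := by
  simp [ψ, WeierstrassCurve.ψ₂, WeierstrassCurve.Affine.evalEval_polynomialY]
/-- `ψ₋ₙ = -ψₙ`. [folklore] -/
@[simp] lemma ψ_neg (n : ℤ) : ψ (-n) = -ψ n := by simp [ψ]
/-- `φₙ = Xψₙ² - ψₙ₊₁ψₙ₋₁`. [folklore] -/
lemma φ_def (n : ℤ) : φ n = xU * ψ n ^ 2 - ψ (n + 1) * ψ (n - 1) := by
  simp [φ, ψ, WeierstrassCurve.φ, evalEval_C]
/-- `φ₀ = 1`. [folklore] -/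
@[simp] lemma φ_zero : φ 0 = 1 := by simp [φ]
/-- `φ₁ = X`. [folklore] -/
@[simp] lemma φ_one : φ 1 = xU := by simp [φ, evalEval_C]
/-- `φ₋ₙ = φₙ`. [folklore] -/
@[simp] lemma φ_neg (n : ℤ) : φ (-n) = φ n := by simp [φ]

section MapValues

variable {S : Type*} [CommRing S] (g : U →+* S)

/-- `ψₙ(X, Y)` specialises along any ring map to the division polynomial of the specialised curve at the specialised point. [folklore] -/
lemma map_ψ (n : ℤ) : g (ψ n) = ((curve.map g).ψ n).evalEval (g xU) (g yU) := by
  rw [ψ, WeierstrassCurve.map_ψ, map_mapRingHom_evalEval]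

/-- `φₙ(X, Y)` specialises along any ring map to `φₙ` of the specialised curve at the specialised point. [folklore] -/
lemma map_φ (n : ℤ) : g (φ n) = ((curve.map g).φ n).evalEval (g xU) (g yU) := by
  rw [φ, WeierstrassCurve.map_φ, map_mapRingHom_evalEval]

end MapValues

/-! ## Non-vanishing of `ψₙ(X, Y)` via the cusp `y² = x³` -/

/-- Specialisation to the cuspidal cubic `y² = x³` over `ℤ` at its point `(1, 1)`. [folklore] -/
def evCusp : U →+* ℤ := ev (⟨0, 0, 0, 0, 0⟩ : WeierstrassCurve ℤ) 1 1

/-- On the cusp `y² = x³` at `(1, 1)`: `ψ₂ = 2`, `ψ₃ = 3`, `ψ₄/ψ₂ = 2`, so `ψₙ(1, 1) = normEDS 2 3 2 n`. [folklore] -/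
lemma evCusp_ψ (n : ℤ) : evCusp (ψ n) = normEDS (2 : ℤ) 3 2 n := by
  have h : (⟨0, 0, 0, 0, 0⟩ : WeierstrassCurve ℤ).toAffine.Equation 1 1 := by
    rw [WeierstrassCurve.Affine.equation_iff]; norm_num
  rw [map_ψ, evCusp, curve_map_ev h, ev_xU, ev_yU, WeierstrassCurve.ψ, ← coe_evalEvalRingHom,
    map_normEDS]
  simp [WeierstrassCurve.ψ₂, WeierstrassCurve.Ψ₃, WeierstrassCurve.preΨ₄,
    WeierstrassCurve.Affine.polynomialY, WeierstrassCurve.b₂, WeierstrassCurve.b₄,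
    WeierstrassCurve.b₆, WeierstrassCurve.b₈]

/-- The normalised EDS with `W₂ = 2`, `W₃ = 3`, `W₄ = 4` is the identity: `Wₙ = n`. [folklore] -/
lemma normEDS_two_three_two (n : ℤ) : normEDS (2 : ℤ) 3 2 n = n := by
  have hnat : ∀ k : ℕ, normEDS (2 : ℤ) 3 2 (k : ℤ) = k := by
    intro k
    induction k using normEDSRec' with
    | zero => simp
    | one => simp
    | two => simp
    | three => simp
    | four => simp
    | even m ih =>
      have key := normEDS_even (2 : ℤ) 3 2 ((m : ℤ) + 3)
      have h1 := ih (m + 1) (by omega)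
      have h2 := ih (m + 2) (by omega)
      have h3 := ih (m + 3) (by omega)
      have h4 := ih (m + 4) (by omega)
      have h5 := ih (m + 5) (by omega)
      push_cast at key h1 h2 h3 h4 h5 ⊢
      rw [show (m : ℤ) + 3 - 1 = m + 2 by ring, show (m : ℤ) + 3 + 2 = m + 5 by ring,
        show (m : ℤ) + 3 - 2 = m + 1 by ring, show (m : ℤ) + 3 + 1 = m + 4 by ring,
        h1, h2, h3, h4, h5] at key
      have h2' : (2 : ℤ) ≠ 0 := two_ne_zero
      have : normEDS (2 : ℤ) 3 2 (2 * ((m : ℤ) + 3)) * 2 = (2 * ((m : ℤ) + 3)) * 2 := by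
        rw [key]; ring
      exact mul_right_cancel₀ h2' this
    | odd m ih =>
      have key := normEDS_odd (2 : ℤ) 3 2 ((m : ℤ) + 2)
      have h1 := ih (m + 1) (by omega)
      have h2 := ih (m + 2) (by omega)
      have h3 := ih (m + 3) (by omega)
      have h4 := ih (m + 4) (by omega)
      push_cast at key h1 h2 h3 h4 ⊢
      rw [show (m : ℤ) + 2 + 2 = m + 4 by ring, show (m : ℤ) + 2 - 1 = m + 1 by ring,
        show (m : ℤ) + 2 + 1 = m + 3 by ring, h1, h2, h3, h4] at key
      rw [key]; ring
  induction n using Int.negInduction with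
  | nat k => exact hnat k
  | neg ih k => rw [normEDS_neg, ih k]

/-- `ψₙ(X, Y) ≠ 0` in `U` for `n ≠ 0` (specialise to the cusp, where `ψₙ(1, 1) = n`). [folklore] -/
lemma ψ_ne_zero {n : ℤ} (hn : n ≠ 0) : ψ n ≠ 0 := fun h => by
  have := congrArg evCusp h
  rw [evCusp_ψ, normEDS_two_three_two, map_zero] at this
  exact hn this

/-! ## Consequences of the elliptic-net relations for `ψₙ(X, Y)` -/

/-- The universal division values form an elliptic net (Xu 2026, Theorem 4.1, tree file
`EllipticNet`: every normalised EDS does). [cite: Xu2026, Theorem 4.1] -/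
theorem isEllipticNet_ψ : IsEllipticNet ψ := by
  rw [ψ_eq_normEDS]
  exact Literature.NumberTheory.EllipticCurves.EllipticNet.isEllipticNet_normEDS _ _ _

/-- The three-index elliptic relation `E(p, q, r, 0)`:
`ψ_{p+q} ψ_{p-q} ψ_r² = ψ_{p+r} ψ_{p-r} ψ_q² - ψ_{q+r} ψ_{q-r} ψ_p²`. [folklore] -/
lemma rel₃ (p q r : ℤ) : ψ (p + q) * ψ (p - q) * ψ r ^ 2 =
    ψ (p + r) * ψ (p - r) * ψ q ^ 2 - ψ (q + r) * ψ (q - r) * ψ p ^ 2 := by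
  have h := isEllipticNet_ψ p q r 0
  rw [IsEllipticNet.rel] at h
  simp only [add_zero] at h
  linear_combination h

/-- The elliptic-net relation `E(m+n, m, m-n, n)` (Xu's `net_add_sub_iff`). [folklore] -/
lemma net_add_sub (m n : ℤ) : ψ (2 * (m + n)) * ψ (m - n) * ψ m * ψ n =
    (ψ (2 * m + n) * ψ (2 * n) * ψ m - ψ (m + 2 * n) * ψ (2 * m) * ψ n) * ψ (m + n) := by
  have h := isEllipticNet_ψ (m + n) m (m - n) n
  rw [IsEllipticNet.rel] at h
  rw [show m + n + m + n = 2 * (m + n) by ring, show m + n - m = n by ring,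
    show m - n + n = m by ring, show m + n + (m - n) + n = 2 * m + n by ring,
    show m + n - (m - n) = 2 * n by ring, show m + (m - n) + n = 2 * m by ring,
    show m - (m - n) = n by ring, show m + n + n = m + 2 * n by ring] at h
  linear_combination h

/-! ## The universal field `K = Frac(U)` and the universal point `P = (X, Y)` -/

/-- The universal field `K = Frac(ℤ[A₁, A₂, A₃, A₄, X, Y])`. [folklore] -/
abbrev K : Type := FractionRing U

/-- Classical decidable equality on the universal field, needed by the affine group law. [folklore] -/
instance : DecidableEq K := Classical.decEq K

/-- The inclusion `U ↪ K`. [folklore] -/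
abbrev ι : U →+* K := algebraMap U K

/-- `U → Frac(U)` is injective (`U` is a domain). [folklore] -/
lemma ι_injective : Function.Injective ι := IsFractionRing.injective U K

/-- Nonzero elements of `U` stay nonzero in `K`. [folklore] -/
lemma ι_ne_zero {u : U} (hu : u ≠ 0) : ι u ≠ 0 := (map_ne_zero_iff ι ι_injective).mpr hu

/-- `ψₙ ≠ 0` in `K` for `n ≠ 0`. [folklore] -/
lemma ιψ_ne_zero {n : ℤ} (hn : n ≠ 0) : ι (ψ n) ≠ 0 := ι_ne_zero (ψ_ne_zero hn)

/-- The universal curve over the universal field. [folklore] -/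
abbrev curveK : WeierstrassCurve K := curve.map ι

/-- `X ∈ K`. [folklore] -/
abbrev xK : K := ι xU
/-- `Y ∈ K`. [folklore] -/
abbrev yK : K := ι yU

/-- The universal point satisfies the universal Weierstrass equation over `K`. [folklore] -/
lemma equation_K : curveK.toAffine.Equation xK yK :=
  WeierstrassCurve.Affine.Equation.map ι equation_xU_yU

/-- `2Y + A₁X + A₃ ≠ 0` in `U` (it is `ψ₂`, which is `2` at the cusp point). [folklore] -/
lemma two_yU_ne_zero : 2 * yU + A₁ * xU + A₃ ≠ 0 := fun h => by
  have := evCusp_ψ 2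
  rw [ψ_two, h, map_zero, normEDS_two] at this
  exact two_ne_zero this.symm

/-- `2Y + a₁X + a₃` computed in `K` is the image of `ψ₂(X, Y)`. [folklore] -/
lemma ψ₂K_eq : 2 * yK + curveK.a₁ * xK + curveK.a₃ = ι (ψ 2) := by
  rw [ψ_two, map_add, map_add, map_mul, map_mul, map_ofNat]
  rfl

/-- The universal point is nonsingular over `K` (its `∂/∂Y` is `ψ₂ ≠ 0`). [folklore] -/
lemma nonsingular_K : curveK.toAffine.Nonsingular xK yK := by
  rw [WeierstrassCurve.Affine.nonsingular_iff']
  refine ⟨equation_K, Or.inr ?_⟩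
  rw [ψ₂K_eq]
  exact ιψ_ne_zero two_ne_zero

/-- The universal point `P = (X, Y) ∈ E_univ(K)`. [folklore] -/
def P : curveK.toAffine.Point := .some xK yK nonsingular_K

/-- The universal point is not the origin. [folklore] -/
lemma P_ne_zero : P ≠ 0 := WeierstrassCurve.Affine.Point.some_ne_zero _

/-! ## The candidate coordinates of `n • P` -/

/-- `Xₙ := φₙ/ψₙ² ∈ K`, to be shown equal to `x(nP)`. [folklore] -/
def Xn (n : ℤ) : K := ι (φ n) / ι (ψ n) ^ 2

/-- `Tₙ := ψ_{2n}/ψₙ⁴ ∈ K`, to be shown equal to `(2y + a₁x + a₃)(nP)`. [folklore] -/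
def Tn (n : ℤ) : K := ι (ψ (2 * n)) / ι (ψ n) ^ 4

/-- `Yₙ := (Tₙ - A₁Xₙ - A₃)/2 ∈ K` (`char K = 0`), to be shown equal to `y(nP)`. [folklore] -/
def Yn (n : ℤ) : K := (Tn n - ι A₁ * Xn n - ι A₃) / 2

/-- `2 ≠ 0` in the universal field (characteristic zero). [folklore] -/
lemma two_ne_zero_K : (2 : K) ≠ 0 := two_ne_zero

/-- `X₀ = 0` (junk value: `ψ₀ = 0`). [folklore] -/
@[simp] lemma Xn_zero : Xn 0 = 0 := by simp [Xn]
/-- `X₁ = X`. [folklore] -/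
@[simp] lemma Xn_one : Xn 1 = xK := by simp [Xn]
/-- `T₁ = ψ₂(X, Y)`. [folklore] -/
@[simp] lemma Tn_one : Tn 1 = ι (ψ 2) := by simp [Tn]
/-- `Y₁ = Y`. [folklore] -/
@[simp] lemma Yn_one : Yn 1 = yK := by
  rw [Yn, Tn_one, Xn_one, ψ_two]
  simp only [map_add, map_mul, map_ofNat]
  field_simp
  ring

/-- `X₋ₙ = Xₙ`. [folklore] -/
lemma Xn_neg (n : ℤ) : Xn (-n) = Xn n := by
  simp [Xn]

/-- `T₋ₙ = -Tₙ`. [folklore] -/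
lemma Tn_neg (n : ℤ) : Tn (-n) = -Tn n := by
  simp only [Tn, mul_neg, ψ_neg, map_neg, neg_div]
  congr 1
  ring

/-- `Xₙ = X - ψₙ₊₁ψₙ₋₁/ψₙ²` for `n ≠ 0`. [folklore] -/
lemma Xn_eq {n : ℤ} (hn : n ≠ 0) : Xn n = xK - ι (ψ (n + 1)) * ι (ψ (n - 1)) / ι (ψ n) ^ 2 := by
  rw [Xn, φ_def, map_sub, map_mul, map_mul, map_pow, sub_div,
    mul_div_cancel_right₀ _ (pow_ne_zero 2 (ιψ_ne_zero hn))]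

/-- `Yₙ - (-Yₙ - a₁Xₙ - a₃) = Tₙ`. [folklore] -/
lemma Yn_sub_negY (n : ℤ) : Yn n - curveK.toAffine.negY (Xn n) (Yn n) = Tn n := by
  rw [WeierstrassCurve.Affine.negY, Yn]
  simp only [WeierstrassCurve.map_a₁, WeierstrassCurve.map_a₃, curve_a₁, curve_a₃]
  field_simp
  ring

/-- `Y₋ₙ = -Yₙ - A₁Xₙ - A₃`, the `y`-coordinate of the negative. [folklore] -/
lemma Yn_neg (n : ℤ) : Yn (-n) = curveK.toAffine.negY (Xn n) (Yn n) := by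
  rw [WeierstrassCurve.Affine.negY, Yn, Yn, Tn_neg, Xn_neg]
  simp only [WeierstrassCurve.map_a₁, WeierstrassCurve.map_a₃, curve_a₁, curve_a₃]
  field_simp
  ring

/-- `X_m - X_n = ψ_{n+m} ψ_{n-m} / (ψ_n ψ_m)²`. [folklore] -/
lemma Xn_sub_Xn {m n : ℤ} (hm : m ≠ 0) (hn : n ≠ 0) :
    Xn m - Xn n = ι (ψ (n + m)) * ι (ψ (n - m)) / (ι (ψ n) * ι (ψ m)) ^ 2 := by
  have h3 := congrArg ι (rel₃ n m 1)
  simp only [map_sub, map_mul, map_pow, ψ_one, one_pow, mul_one] at h3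
  rw [Xn_eq hm, Xn_eq hn, sub_sub_sub_cancel_left, div_sub_div _ _ (pow_ne_zero 2 (ιψ_ne_zero hn))
    (pow_ne_zero 2 (ιψ_ne_zero hm)), mul_pow, h3]
  ring

/-- `Xₙ ≠ 0` for `n ≠ 0` (at the cusp point, `φₙ(1, 1) = n² - (n + 1)(n - 1) = 1`). [folklore] -/
lemma Xn_ne_zero {n : ℤ} (hn : n ≠ 0) : Xn n ≠ 0 := by
  intro h
  rw [Xn, div_eq_zero_iff, or_iff_left (pow_ne_zero 2 (ιψ_ne_zero hn)),
    map_eq_zero_iff ι ι_injective] at h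
  have := congrArg evCusp h
  rw [map_φ, evCusp, curve_map_ev (by rw [WeierstrassCurve.Affine.equation_iff]; norm_num), ev_xU,
    ev_yU, map_zero, WeierstrassCurve.φ] at this
  simp only [evalEval_sub, evalEval_mul, evalEval_C, eval_X, evalEval_pow, one_mul] at this
  have hψ : ∀ k : ℤ, ((⟨0, 0, 0, 0, 0⟩ : WeierstrassCurve ℤ).ψ k).evalEval 1 1 = k := fun k => by
    have e := evCusp_ψ k
    rwa [normEDS_two_three_two, map_ψ, evCusp, curve_map_ev (by
      rw [WeierstrassCurve.Affine.equation_iff]; norm_num), ev_xU, ev_yU] at e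
  rw [hψ, hψ, hψ] at this
  have : (1 : ℤ) = 0 := by linear_combination this
  exact one_ne_zero this

/-- `Xₘ ≠ Xₙ` unless `m = ±n`. [folklore] -/
lemma Xn_ne_Xn {m n : ℤ} (hne : m ≠ n) (hne' : m ≠ -n) : Xn m ≠ Xn n := by
  rcases eq_or_ne m 0 with rfl | hm
  · rw [Xn_zero]; exact (Xn_ne_zero (Ne.symm hne)).symm
  rcases eq_or_ne n 0 with rfl | hn
  · rw [Xn_zero]; exact Xn_ne_zero hne
  rw [Ne, ← sub_eq_zero, Xn_sub_Xn hm hn, div_eq_zero_iff, not_or]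
  refine ⟨mul_ne_zero (ιψ_ne_zero ?_) (ιψ_ne_zero ?_),
    pow_ne_zero 2 (mul_ne_zero (ιψ_ne_zero hn) (ιψ_ne_zero hm))⟩
  · intro h; exact hne' (by linear_combination h)
  · intro h; exact hne (by linear_combination -h)

/-- `X_{n-m} - X_{n+m} = ψ_{2n} ψ_{2m} / (ψ_{n+m} ψ_{n-m})²`. [folklore] -/
lemma Xn_sub_sub_Xn_add {m n : ℤ} (hadd : n + m ≠ 0) (hsub : n - m ≠ 0) :
    Xn (n - m) - Xn (n + m) = ι (ψ (2 * n)) * ι (ψ (2 * m)) / (ι (ψ (n + m)) * ι (ψ (n - m))) ^ 2 := by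
  rw [Xn_sub_Xn hsub hadd]
  ring_nf

/-- The `x`-coordinate recursion `X_{n+m} = X_{n-m} - T_n T_m / (X_m - X_n)²`. [folklore] -/
lemma Xn_add {m n : ℤ} (hm : m ≠ 0) (hn : n ≠ 0) (hadd : n + m ≠ 0) (hsub : n - m ≠ 0) :
    Xn (n + m) = Xn (n - m) - Tn n * Tn m / (Xn m - Xn n) ^ 2 := by
  rw [eq_sub_iff_add_eq, ← eq_sub_iff_add_eq', Xn_sub_sub_Xn_add hadd hsub,
    Xn_sub_Xn hm hn, Tn, Tn]
  have h1 := ιψ_ne_zero hm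
  have h2 := ιψ_ne_zero hn
  have h3 := ιψ_ne_zero hadd
  have h4 := ιψ_ne_zero hsub
  field_simp

/-- The `ψ₂`-coordinate recursion
`T_{n+m} = (T_m (X_n - X_{n+m}) - T_n (X_m - X_{n+m})) / (X_m - X_n)`. [folklore] -/
lemma Tn_add {m n : ℤ} (hm : m ≠ 0) (hn : n ≠ 0) (hadd : n + m ≠ 0) (hsub : n - m ≠ 0) :
    Tn (n + m) = (Tn m * (Xn n - Xn (n + m)) - Tn n * (Xn m - Xn (n + m))) / (Xn m - Xn n) := by
  have hnet' := congrArg ι (net_add_sub n m)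
  simp only [map_sub, map_mul] at hnet'
  rw [Xn_sub_Xn hn hadd, Xn_sub_Xn hm hadd, Xn_sub_Xn hm hn, Tn, Tn, Tn,
    show n + m - n = m by ring, show n + m + n = 2 * n + m by ring, show n + m - m = n by ring,
    show n + m + m = n + 2 * m by ring, show 2 * (n + m) = 2 * (n + m) by rfl]
  have h1 := ιψ_ne_zero hm
  have h2 := ιψ_ne_zero hn
  have h3 := ιψ_ne_zero hadd
  have h4 := ιψ_ne_zero hsub
  rw [eq_div_iff (div_ne_zero (mul_ne_zero h3 h4) (pow_ne_zero 2 (mul_ne_zero h2 h1)))]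
  field_simp
  rw [show n - m = -(m - n) by ring, ψ_neg, map_neg] at hnet' ⊢
  linear_combination hnet'

/-! ## Doubling the universal point -/

section Doubling

variable {F : Type*} [Field F] [DecidableEq F] (V : WeierstrassCurve F)

/-- The `ψ₂`-value of `2Q` for an affine point `Q = (x, y)` with `2Q ≠ O`:
`(2y(2Q) + a₁x(2Q) + a₃) · (2y + a₁x + a₃)³ = preΨ₄(x)`, i.e. `ψ₂(2Q) = ψ₄(Q)/ψ₂(Q)⁴`.
Silverman, *AEC*, Exercise 3.7 and Group Law Algorithm III.2.3. [folklore] -/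
theorem addY_self_sub_negY_mul_cube {x y : F} (h : V.toAffine.Equation x y)
    (hy : y ≠ V.toAffine.negY x y) :
    (V.toAffine.addY x x y (V.toAffine.slope x x y y) -
        V.toAffine.negY (V.toAffine.addX x x (V.toAffine.slope x x y y))
          (V.toAffine.addY x x y (V.toAffine.slope x x y y))) *
      (y - V.toAffine.negY x y) ^ 3 = V.preΨ₄.eval x := by
  have key := V.addX_self_sub_mul_sq h hy
  set ℓ := V.toAffine.slope x x y y with hℓ
  set X₃ := V.toAffine.addX x x ℓ with hX₃
  have hd : y - V.toAffine.negY x y ≠ 0 := sub_ne_zero.mpr hy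
  have hℓd : ℓ * (y - V.toAffine.negY x y) = 3 * x ^ 2 + 2 * V.a₂ * x + V.a₄ - V.a₁ * y := by
    rw [hℓ, WeierstrassCurve.Affine.slope_of_Y_ne rfl hy, div_mul_cancel₀ _ hd]
  have e1 : V.toAffine.addY x x y ℓ - V.toAffine.negY X₃ (V.toAffine.addY x x y ℓ) =
      -(2 * ℓ + V.a₁) * (X₃ - x) - (y - V.toAffine.negY x y) := by
    rw [hX₃]
    simp only [WeierstrassCurve.Affine.addY, WeierstrassCurve.Affine.negAddY,
      WeierstrassCurve.Affine.negY]
    ring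
  rw [e1]
  have e2 : (-(2 * ℓ + V.a₁) * (X₃ - x) - (y - V.toAffine.negY x y)) *
      (y - V.toAffine.negY x y) ^ 3 =
      (2 * (ℓ * (y - V.toAffine.negY x y)) + V.a₁ * (y - V.toAffine.negY x y)) *
        (-((X₃ - x) * (y - V.toAffine.negY x y) ^ 2)) - (y - V.toAffine.negY x y) ^ 4 := by
    ring
  rw [e2, key, hℓd, neg_neg, WeierstrassCurve.Affine.negY, WeierstrassCurve.Ψ₃,
    WeierstrassCurve.preΨ₄]
  simp only [eval_add, eval_mul, eval_pow, eval_C, eval_X, eval_ofNat,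
    WeierstrassCurve.b₂, WeierstrassCurve.b₄, WeierstrassCurve.b₆, WeierstrassCurve.b₈]
  have heq := (WeierstrassCurve.Affine.equation_iff ..).mp h
  linear_combination (-(16 * x ^ 3 + 8 * V.a₁ ^ 2 * x ^ 2 + 16 * V.a₂ * x ^ 2
    + 16 * V.a₁ * x * y + 16 * V.a₁ * V.a₃ * x + 16 * V.a₄ * x + 16 * y ^ 2 + 16 * V.a₃ * y
    + 8 * V.a₃ ^ 2 + 16 * V.a₆)) * heq

end Doubling

/-- The universal point is not `2`-torsion: `Y ≠ -Y - A₁X - A₃`. [folklore] -/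
lemma yK_ne_negY : yK ≠ curveK.toAffine.negY xK yK := by
  rw [Ne, ← sub_eq_zero, ← Yn_one, ← Xn_one, Yn_sub_negY, Tn_one]
  exact ιψ_ne_zero two_ne_zero

/-- `Y - (-Y - A₁X - A₃) = T₁ = ψ₂(X, Y)`. [folklore] -/
lemma yK_sub_negY : yK - curveK.toAffine.negY xK yK = Tn 1 := by
  rw [Tn_one, ← ψ₂K_eq, WeierstrassCurve.Affine.negY]; ring

/-- `ψ₃(X, Y) = Ψ₃(X)` in `K`. [folklore] -/
lemma ιψ_three : ι (ψ 3) = curveK.Ψ₃.eval xK := by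
  rw [ψ, WeierstrassCurve.ψ_three, evalEval_C, WeierstrassCurve.map_Ψ₃, eval_map, eval₂_at_apply]

/-- `ψ₄(X, Y) = preΨ₄(X) · ψ₂(X, Y)` in `K`. [folklore] -/
lemma ιψ_four : ι (ψ 4) = curveK.preΨ₄.eval xK * ι (ψ 2) := by
  rw [ψ, WeierstrassCurve.ψ_four, evalEval_mul, evalEval_C, map_mul, WeierstrassCurve.map_preΨ₄,
    eval_map, eval₂_at_apply, ← WeierstrassCurve.ψ_two, ← ψ]

/-- `x(2P) = X₂`. [folklore] -/
lemma addX_P_P : curveK.toAffine.addX xK xK (curveK.toAffine.slope xK xK yK yK) = Xn 2 := by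
  have key := curveK.addX_self_sub_mul_sq equation_K yK_ne_negY
  rw [yK_sub_negY, Tn_one, ← ιψ_three] at key
  have h2 := pow_ne_zero 2 (ιψ_ne_zero (n := 2) two_ne_zero)
  rw [Xn_eq two_ne_zero, show (2 : ℤ) + 1 = 3 by rfl, show (2 : ℤ) - 1 = 1 by rfl, ψ_one, map_one,
    mul_one]
  have key' := (eq_div_iff h2).mpr key
  linear_combination key'

/-- Over `K` (`char K = 0`), `y` is determined by `x` and `2y + a₁x + a₃`. [folklore] -/
lemma Y_eq_of_sub_negY_eq {x y y' : K}
    (h : y - curveK.toAffine.negY x y = y' - curveK.toAffine.negY x y') : y = y' := by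
  rw [WeierstrassCurve.Affine.negY, WeierstrassCurve.Affine.negY] at h
  have : (2 : K) * y = 2 * y' := by linear_combination h
  exact mul_left_cancel₀ two_ne_zero_K this

/-- `y(2P) = Y₂`. [folklore] -/
lemma addY_P_P :
    curveK.toAffine.addY xK xK yK (curveK.toAffine.slope xK xK yK yK) = Yn 2 := by
  have key := addY_self_sub_negY_mul_cube curveK equation_K yK_ne_negY
  rw [yK_sub_negY, Tn_one] at key
  have h2 := ιψ_ne_zero (n := 2) two_ne_zero
  refine Y_eq_of_sub_negY_eq
    (x := curveK.toAffine.addX xK xK (curveK.toAffine.slope xK xK yK yK)) ?_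
  rw [(eq_div_iff (pow_ne_zero 3 h2)).mpr key, addX_P_P, Yn_sub_negY, Tn,
    show (2 : ℤ) * 2 = 4 by rfl, ιψ_four]
  field_simp

/-! ## The multiples of the universal point -/

/-- Affine points with equal coordinates are equal (transporting the nonsingularity proof). [folklore] -/
lemma some_eq_some_of_eq {R : Type*} [CommRing R] {W : WeierstrassCurve R} {x x' y y' : R}
    (hx : x = x') (hy : y = y') (h : W.toAffine.Nonsingular x y) :
    ∃ h' : W.toAffine.Nonsingular x' y',
      WeierstrassCurve.Affine.Point.some x y h = .some x' y' h' := by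
  subst hx hy
  exact ⟨h, rfl⟩

/-- `2 • P = (X₂, Y₂)` (duplication formula, Silverman *AEC* III.2.3(d)). [folklore] -/
lemma two_smul_P :
    ∃ h : curveK.toAffine.Nonsingular (Xn 2) (Yn 2), (2 : ℤ) • P = .some _ _ h := by
  rw [two_zsmul, P, WeierstrassCurve.Affine.Point.add_self_of_Y_ne yK_ne_negY]
  exact some_eq_some_of_eq addX_P_P addY_P_P _

/-- The induction step: from `m • P = (X_m, Y_m)` and `(m - 1) • P = (X_{m-1}, Y_{m-1})` to
`(m + 1) • P = (X_{m+1}, Y_{m+1})`, for `m ∉ {-1, 0, 1}`. [folklore] -/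
lemma zsmul_P_step {m : ℤ} (hm : m ≠ 0) (hm₁ : m ≠ 1) (hm₂ : m ≠ -1)
    (h2 : ∃ ns2 : curveK.toAffine.Nonsingular (Xn m) (Yn m), m • P = .some _ _ ns2)
    (h1 : ∃ ns1 : curveK.toAffine.Nonsingular (Xn (m - 1)) (Yn (m - 1)),
      (m - 1) • P = .some _ _ ns1) :
    ∃ h : curveK.toAffine.Nonsingular (Xn (m + 1)) (Yn (m + 1)), (m + 1) • P = .some _ _ h := by
  obtain ⟨ns2, eq2⟩ := h2
  obtain ⟨ns1, eq1⟩ := h1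
  have hadd : m + 1 ≠ 0 := fun h => hm₂ (by linear_combination h)
  have hsub' : m - 1 ≠ 0 := sub_ne_zero.mpr hm₁
  have hne : Xn m ≠ Xn 1 := Xn_ne_Xn hm₁ hm₂
  have hne' : Xn m ≠ xK := by rwa [Xn_one] at hne
  -- `(m - 1) • P = m • P - P` gives `x(mP - P) = X_{m-1}`
  have hsub : (m - 1) • P = m • P + -P := by
    rw [sub_zsmul, one_zsmul]
  rw [eq2, eq1, P, WeierstrassCurve.Affine.Point.neg_some,
    WeierstrassCurve.Affine.Point.add_of_X_ne
      (h₂ := (WeierstrassCurve.Affine.nonsingular_neg ..).mpr nonsingular_K) hne'] at hsub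
  simp only [WeierstrassCurve.Affine.Point.some.injEq] at hsub
  obtain ⟨hX1, -⟩ := hsub
  -- the new point
  rw [add_zsmul, one_zsmul, eq2, P, WeierstrassCurve.Affine.Point.add_of_X_ne
    (h₂ := nonsingular_K) hne']
  have hX : curveK.toAffine.addX (Xn m) xK (curveK.toAffine.slope (Xn m) xK (Yn m) yK) =
      Xn (m + 1) := by
    rw [Xn_add one_ne_zero hm hadd hsub', WeierstrassCurve.Affine.addX_eq_addX_negY_sub _ _ hne',
      ← hX1, Yn_sub_negY, yK_sub_negY, Xn_one]
  have hY : curveK.toAffine.addY (Xn m) xK (Yn m) (curveK.toAffine.slope (Xn m) xK (Yn m) yK) =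
      Yn (m + 1) := by
    have key := curveK.toAffine.addY_sub_negY_addY (Yn m) yK hne'
    simp only at key
    refine Y_eq_of_sub_negY_eq
      (x := curveK.toAffine.addX (Xn m) xK (curveK.toAffine.slope (Xn m) xK (Yn m) yK)) ?_
    rw [key, hX, Yn_sub_negY, Yn_sub_negY, yK_sub_negY, Tn_add one_ne_zero hm hadd hsub',
      Xn_one]
  exact some_eq_some_of_eq hX hY _

/-- **The multiples of the universal point** (after J. Xu, Mathlib PR 13782,
`zsmul_point_eq_smulX_smulY`): for `n ≠ 0`, `n • (X, Y) = (φₙ/ψₙ², Yₙ)` on the universal curve over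
`K`, where `2Yₙ + A₁φₙ/ψₙ² + A₃ = ψ₂ₙ/ψₙ⁴`. Silverman, *AEC*, Exercise 3.7(d). [folklore] -/
theorem zsmul_P {n : ℤ} (hn : n ≠ 0) :
    ∃ h : curveK.toAffine.Nonsingular (Xn n) (Yn n), n • P = .some _ _ h := by
  induction n using Int.negInduction with
  | nat n =>
    induction n using Nat.strong_induction_on with
    | _ n ih =>
    rcases n with _ | _ | _ | n
    · exact (hn rfl).elim
    · simp only [zero_add, Nat.cast_one, one_zsmul, Xn_one, Yn_one]
      exact ⟨nonsingular_K, rfl⟩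
    · have h2 : ((0 + 1 + 1 : ℕ) : ℤ) = 2 := by norm_num
      simp only [h2]
      exact two_smul_P
    · have e0 : ((n + 1 + 1 + 1 : ℕ) : ℤ) = ((n + 1 + 1 : ℕ) : ℤ) + 1 := by push_cast; ring
      have e1 : ((n + 1 : ℕ) : ℤ) = ((n + 1 + 1 : ℕ) : ℤ) - 1 := by push_cast; ring
      have h2 := ih (n + 1 + 1) (by omega) (by omega)
      have h1 := ih (n + 1) (by omega) (by omega)
      rw [e1] at h1
      rw [e0]
      exact zsmul_P_step (by omega) (by omega) (by omega) h2 h1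
  | neg ih n =>
    obtain ⟨ns, eq⟩ := ih n (by simpa using hn)
    rw [neg_zsmul, eq, WeierstrassCurve.Affine.Point.neg_some]
    exact some_eq_some_of_eq (Xn_neg n).symm (Yn_neg n).symm _


/-! ## The polynomials `ωₙ ∈ U` -/

/-- `ω̃ₙ := Yₙ · ψₙ³ ∈ K`, the numerator of the `y`-coordinate of `n • P`. [folklore] -/
def ωK (n : ℤ) : K := Yn n * ι (ψ n) ^ 3

/-- `φₙ = Xₙ ψₙ²` in `K` (`n ≠ 0`). [folklore] -/
lemma ιφ_eq {n : ℤ} (hn : n ≠ 0) : ι (φ n) = Xn n * ι (ψ n) ^ 2 := by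
  rw [Xn, div_mul_cancel₀ _ (pow_ne_zero 2 (ιψ_ne_zero hn))]

/-- `(Xₙ, Yₙ)` lies on the universal curve (`n ≠ 0`). [folklore] -/
lemma equation_Xn_Yn {n : ℤ} (hn : n ≠ 0) : curveK.toAffine.Equation (Xn n) (Yn n) :=
  (zsmul_P hn).choose.1

/-- `ω̃ₙ` is a root of the monic quadratic
`T² + (A₁φₙψₙ + A₃ψₙ³) T − (φₙ³ + A₂φₙ²ψₙ² + A₄φₙψₙ⁴ + A₆ψₙ⁶)` over `U`
(the Weierstrass equation for `n • P` multiplied by `ψₙ⁶`). [folklore] -/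
lemma ωK_quadratic {n : ℤ} (hn : n ≠ 0) :
    ωK n ^ 2 + ι (A₁ * φ n * ψ n + A₃ * ψ n ^ 3) * ωK n
      - ι (φ n ^ 3 + A₂ * φ n ^ 2 * ψ n ^ 2 + A₄ * φ n * ψ n ^ 4 + A₆ * ψ n ^ 6) = 0 := by
  have h := (Affine.equation_iff ..).mp (equation_Xn_Yn hn)
  simp only [map_a₁, map_a₂, map_a₃, map_a₄, map_a₆, curve_a₁, curve_a₂, curve_a₃, curve_a₄,
    curve_a₆] at h
  simp only [map_add, map_mul, map_pow, ιφ_eq hn, ωK]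
  linear_combination ι (ψ n) ^ 6 * h

/-- `ω̃ₙ` is integral over `U`. [folklore] -/
lemma isIntegral_ωK {n : ℤ} (hn : n ≠ 0) : IsIntegral U (ωK n) := by
  refine ⟨X ^ 2 + (C (A₁ * φ n * ψ n + A₃ * ψ n ^ 3) * X +
      C (-(φ n ^ 3 + A₂ * φ n ^ 2 * ψ n ^ 2 + A₄ * φ n * ψ n ^ 4 + A₆ * ψ n ^ 6))), ?_, ?_⟩
  · exact (monic_X_pow 2).add_of_left
      (lt_of_le_of_lt degree_linear_le (by rw [degree_X_pow]; norm_num))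
  · have h := ωK_quadratic hn
    simp only [eval₂_add, eval₂_mul, eval₂_pow, eval₂_X, eval₂_C, eval₂_neg, map_neg]
    linear_combination h

/-- `ω̃ₙ ∈ U`: `U = ℤ[A₁, A₂, A₃, A₄, X, Y]` is a UFD, hence integrally closed. [folklore] -/
lemma exists_ι_eq_ωK {n : ℤ} (hn : n ≠ 0) : ∃ w : U, ι w = ωK n :=
  IsIntegrallyClosed.algebraMap_eq_of_integral (isIntegral_ωK hn)

/-- **The polynomial `ωₙ ∈ ℤ[A₁, A₂, A₃, A₄, X, Y]`** (Silverman, *AEC*, Exercise 3.7: the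
numerator of `y ∘ [n]`): for `n ≠ 0` the unique element of `U` with `ωₙ = y(nP) · ψₙ³` in the
universal field, and `ω₀ := 1` (so that `(φ₀, ω₀, ψ₀) = (1, 1, 0)` is Mathlib's representative of
`O` in Jacobian coordinates). [cite: SilvermanAEC2009, Exercise 3.7(d)] -/
def ω (n : ℤ) : U := if hn : n = 0 then 1 else (exists_ι_eq_ωK hn).choose

/-- `ω₀ = 1`. [folklore] -/
@[simp] lemma ω_zero : ω 0 = 1 := by simp [ω]

/-- The characterisation of `ωₙ` for `n ≠ 0`: `ωₙ = Yₙ ψₙ³` in `K`. [folklore] -/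
lemma ι_ω {n : ℤ} (hn : n ≠ 0) : ι (ω n) = Yn n * ι (ψ n) ^ 3 := by
  rw [ω, dif_neg hn]
  exact (exists_ι_eq_ωK hn).choose_spec

/-- `ω₁ = Y`. [folklore] -/
@[simp] lemma ω_one : ω 1 = yU :=
  ι_injective (by rw [ι_ω one_ne_zero, Yn_one, ψ_one, map_one, one_pow, mul_one])

/-- `ω₋ₙ = ωₙ + A₁φₙψₙ + A₃ψₙ³` (the numerator of `y(−nP) = −y(nP) − a₁x(nP) − a₃`, taking the
sign `ψ₋ₙ = −ψₙ` into account). [folklore] -/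
lemma ω_neg (n : ℤ) : ω (-n) = ω n + A₁ * φ n * ψ n + A₃ * ψ n ^ 3 := by
  rcases eq_or_ne n 0 with rfl | hn
  · simp
  apply ι_injective
  rw [ι_ω (neg_ne_zero.mpr hn), Yn_neg, ψ_neg, Affine.negY, map_add, map_add, ι_ω hn, map_mul,
    map_mul, map_mul, map_pow, ιφ_eq hn, map_neg]
  simp only [map_a₁, map_a₃, curve_a₁, curve_a₃]
  ring

/-! ## The Jacobian triples `(φₙ, ωₙ, ψₙ)` -/

/-- The triple `Tₙ := (φₙ, ωₙ, ψₙ) ∈ U³`, a representative of `n • P` in Mathlib's Jacobian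
coordinates `[X : Y : Z] ↦ (X/Z², Y/Z³)`. [cite: SilvermanAEC2009, Exercise 3.7(d)] -/
def T (n : ℤ) : Fin 3 → U := ![φ n, ω n, ψ n]

/-- `T₁ = (X, Y, 1)`. [folklore] -/
@[simp] lemma T_one : T 1 = ![xU, yU, 1] := by simp [T]

/-- `T₀ = (1, 1, 0)`. [folklore] -/
@[simp] lemma T_zero : T 0 = ![1, 1, 0] := by simp [T]

/-- Components of `ι ∘ Tₙ`. [folklore] -/
lemma ιT_apply (n : ℤ) : (ι ∘ T n) 0 = ι (φ n) ∧ (ι ∘ T n) 1 = ι (ω n) ∧ (ι ∘ T n) 2 = ι (ψ n) :=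
  ⟨rfl, rfl, rfl⟩

/-- Over the universal field, `ι ∘ Tₙ` is a nonsingular representative with affine image `n • P`
(`n ≠ 0`). [folklore] -/
lemma nonsingular_ιT {n : ℤ} (hn : n ≠ 0) : Jacobian.Nonsingular curveK (ι ∘ T n) ∧
    Jacobian.Point.toAffine curveK (ι ∘ T n) = n • P := by
  obtain ⟨hns, hP⟩ := zsmul_P hn
  obtain ⟨h0, h1, h2⟩ := ιT_apply n
  have hz : (ι ∘ T n) 2 ≠ 0 := h2 ▸ ιψ_ne_zero hn
  have hx : (ι ∘ T n) 0 / (ι ∘ T n) 2 ^ 2 = Xn n := by rw [h0, h2, Xn]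
  have hy : (ι ∘ T n) 1 / (ι ∘ T n) 2 ^ 3 = Yn n := by
    rw [h1, h2, ι_ω hn, mul_div_cancel_right₀ _ (pow_ne_zero 3 (ιψ_ne_zero hn))]
  have hns' : Jacobian.Nonsingular curveK (ι ∘ T n) :=
    (Jacobian.nonsingular_of_Z_ne_zero hz).mpr (by rw [hx, hy]; exact hns)
  refine ⟨hns', ?_⟩
  rw [Jacobian.Point.toAffine_of_Z_ne_zero hns' hz, hP]
  simp only [Affine.Point.some.injEq]
  exact ⟨hx, hy⟩

/-- Two nonsingular Jacobian representatives over a field with the same nonzero `Z`-coordinate and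
the same affine image are equal. [folklore] -/
lemma _root_.WeierstrassCurve.Jacobian.eq_of_toAffine_eq {F : Type*} [Field F]
    {W : WeierstrassCurve F} {P Q : Fin 3 → F} (hP : Jacobian.Nonsingular W P)
    (hQ : Jacobian.Nonsingular W Q) (hPz : P 2 ≠ 0) (hz : P 2 = Q 2)
    (h : Jacobian.Point.toAffine W P = Jacobian.Point.toAffine W Q) : P = Q := by
  have hQz : Q 2 ≠ 0 := hz ▸ hPz
  rw [Jacobian.Point.toAffine_of_Z_ne_zero hP hPz, Jacobian.Point.toAffine_of_Z_ne_zero hQ hQz,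
    Affine.Point.some.injEq, hz] at h
  obtain ⟨hx, hy⟩ := h
  funext i
  fin_cases i
  · exact (div_left_inj' (pow_ne_zero 2 hQz)).mp hx
  · exact (div_left_inj' (pow_ne_zero 3 hQz)).mp hy
  · exact hz

/-- `Z(2 · Tₙ) = ψ₂ₙ` in `K`: the `Z`-coordinate of Mathlib's doubling of `ι ∘ Tₙ` is
`ψₙ · (2ωₙ + A₁φₙψₙ + A₃ψₙ³) = ψₙ⁴ · ψ₂(nP) = ψ₂ₙ`. [folklore] -/
lemma dblZ_ιT {n : ℤ} (hn : n ≠ 0) : Jacobian.dblZ curveK (ι ∘ T n) = ι (ψ (2 * n)) := by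
  obtain ⟨h0, h1, h2⟩ := ιT_apply n
  have key := Yn_sub_negY n
  rw [Affine.negY, Tn] at key
  simp only [map_a₁, map_a₃, curve_a₁, curve_a₃] at key
  rw [Jacobian.dblZ, Jacobian.negY, h0, h1, h2, ι_ω hn, ιφ_eq hn]
  simp only [map_a₁, map_a₃, curve_a₁, curve_a₃]
  have hψ := ιψ_ne_zero hn
  rw [eq_div_iff (pow_ne_zero 4 hψ)] at key
  linear_combination key

/-- `Z(Tₙ + Tₙ₊₁) = ψ₂ₙ₊₁` in `K`: `φₙψₙ₊₁² − φₙ₊₁ψₙ² = ψ₂ₙ₊₁` (the relation `E(n+1, n, 1)`).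
[folklore] -/
lemma addZ_ιT {n : ℤ} (hn : n ≠ 0) (hn' : n + 1 ≠ 0) :
    Jacobian.addZ (ι ∘ T n) (ι ∘ T (n + 1)) = ι (ψ (2 * n + 1)) := by
  obtain ⟨h0, -, h2⟩ := ιT_apply n
  obtain ⟨h0', -, h2'⟩ := ιT_apply (n + 1)
  have key := Xn_sub_Xn (m := n) (n := n + 1) hn hn'
  rw [show n + 1 + n = 2 * n + 1 by ring, show n + 1 - n = 1 by ring, ψ_one, map_one, mul_one]
    at key
  rw [Jacobian.addZ, h0, h2, h0', h2', ιφ_eq hn, ιφ_eq hn']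
  have h1 := ιψ_ne_zero hn
  have h2 := ιψ_ne_zero hn'
  rw [eq_div_iff (pow_ne_zero 2 (mul_ne_zero h2 h1))] at key
  linear_combination key

/-- **Doubling identity** in `U³`: `dblXYZ (φₙ, ωₙ, ψₙ) = (φ₂ₙ, ω₂ₙ, ψ₂ₙ)` for `n ≠ 0` (exact
equality of Mathlib's polynomial doubling formulas, not just projective equivalence: both sides
represent `2n • P` over `K` and have the same `Z`-coordinate `ψ₂ₙ`). [folklore] -/
theorem dblXYZ_T {n : ℤ} (hn : n ≠ 0) : Jacobian.dblXYZ curve (T n) = T (2 * n) := by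
  have h2n : 2 * n ≠ 0 := mul_ne_zero two_ne_zero hn
  obtain ⟨hns, hto⟩ := nonsingular_ιT hn
  obtain ⟨hns2, hto2⟩ := nonsingular_ιT h2n
  have hK : Jacobian.dblXYZ curveK (ι ∘ T n) = ι ∘ T (2 * n) := by
    refine Jacobian.eq_of_toAffine_eq (by rw [← Jacobian.add_self]; exact Jacobian.nonsingular_add hns hns)
      hns2 ?_ ?_ ?_
    · rw [Jacobian.dblXYZ_Z, dblZ_ιT hn]; exact ιψ_ne_zero h2n
    · rw [Jacobian.dblXYZ_Z, dblZ_ιT hn]; rfl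
    · rw [← Jacobian.add_self, Jacobian.Point.toAffine_add hns hns, hto, hto2, ← add_zsmul, two_mul]
  have hmap := Jacobian.map_dblXYZ (W' := curve) ι (T n)
  rw [hK] at hmap
  exact (ι_injective.comp_left hmap).symm

/-- **Addition identity** in `U³`: `addXYZ (φₙ, ωₙ, ψₙ) (φₙ₊₁, ωₙ₊₁, ψₙ₊₁) = (φ₂ₙ₊₁, ω₂ₙ₊₁, ψ₂ₙ₊₁)`
for `n ∉ {0, −1}` (both sides represent `(2n+1) • P` over `K`, where `nP ≠ (n+1)P`, and have the
same `Z`-coordinate `ψ₂ₙ₊₁`). [folklore] -/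
theorem addXYZ_T {n : ℤ} (hn : n ≠ 0) (hn' : n + 1 ≠ 0) :
    Jacobian.addXYZ curve (T n) (T (n + 1)) = T (2 * n + 1) := by
  have h2n : 2 * n + 1 ≠ 0 := by omega
  obtain ⟨hns, hto⟩ := nonsingular_ιT hn
  obtain ⟨hns1, hto1⟩ := nonsingular_ιT hn'
  obtain ⟨hns2, hto2⟩ := nonsingular_ιT h2n
  have hne : ¬ (ι ∘ T n) ≈ (ι ∘ T (n + 1)) := fun h => by
    have := Jacobian.Point.toAffine_of_equiv (W := curveK) h
    rw [hto, hto1, add_zsmul, one_zsmul, left_eq_add] at this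
    exact P_ne_zero this
  have hK : Jacobian.addXYZ curveK (ι ∘ T n) (ι ∘ T (n + 1)) = ι ∘ T (2 * n + 1) := by
    refine Jacobian.eq_of_toAffine_eq
      (by rw [← Jacobian.add_of_not_equiv hne]; exact Jacobian.nonsingular_add hns hns1) hns2 ?_ ?_ ?_
    · rw [Jacobian.addXYZ_Z, addZ_ιT hn hn']; exact ιψ_ne_zero h2n
    · rw [Jacobian.addXYZ_Z, addZ_ιT hn hn']; rfl
    · rw [← Jacobian.add_of_not_equiv hne, Jacobian.Point.toAffine_add hns hns1, hto, hto1, hto2,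
        ← add_zsmul]
      congr 1; ring
  have hmap := Jacobian.map_addXYZ (W' := curve) ι (T n) (T (n + 1))
  rw [hK] at hmap
  exact (ι_injective.comp_left hmap).symm

end UnivEC

end Literature.NumberTheory.EllipticCurves

/-! ## Specialisation: multiplication by `n` on every Weierstrass curve over a field -/

namespace WeierstrassCurve

namespace Affine

namespace Point

open Literature.NumberTheory.EllipticCurves

variable {F : Type*} [Field F] {V : WeierstrassCurve F} {x₀ y₀ : F}

/-- The value `ωₙ(x₀, y₀)` of the universal polynomial `ωₙ ∈ ℤ[A₁, A₂, A₃, A₄, X, Y]` at a point of a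
Weierstrass curve `V` (`Aᵢ ↦ aᵢ`). Silverman, *AEC*, Exercise 3.7. [folklore] -/
def ωEval (V : WeierstrassCurve F) (x₀ y₀ : F) (n : ℤ) : F := UnivEC.ev V x₀ y₀ (UnivEC.ω n)

/-- The specialised triple `(φₙ(Q), ωₙ(Q), ψₙ(Q))`. [folklore] -/
def smulTriple (V : WeierstrassCurve F) (x₀ y₀ : F) (n : ℤ) : Fin 3 → F :=
  UnivEC.ev V x₀ y₀ ∘ UnivEC.T n

/-- On a point of `V`, the specialised triple is `(φₙ(Q), ωₙ(Q), ψₙ(Q))` with Mathlib's `φₙ`, `ψₙ`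
of `V`. [folklore] -/
lemma smulTriple_eq (h : V.toAffine.Equation x₀ y₀) (n : ℤ) : smulTriple V x₀ y₀ n =
    ![(V.φ n).evalEval x₀ y₀, ωEval V x₀ y₀ n, (V.ψ n).evalEval x₀ y₀] := by
  rw [smulTriple, UnivEC.T, Jacobian.comp_fin3, UnivEC.map_φ, UnivEC.map_ψ, UnivEC.curve_map_ev h,
    UnivEC.ev_xU, UnivEC.ev_yU, ωEval]

/-- The specialised triple for `n = 1` is `(x₀, y₀, 1)`. [folklore] -/
lemma smulTriple_one (n : ℤ) (hn : n = 1) : smulTriple V x₀ y₀ n = ![x₀, y₀, 1] := by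
  subst hn
  rw [smulTriple, UnivEC.T_one, Jacobian.comp_fin3, UnivEC.ev_xU, UnivEC.ev_yU, map_one]

/-- The doubling identity `dblXYZ_T` specialised to `V`: `dblXYZ (φₙ(Q), ωₙ(Q), ψₙ(Q)) =
(φ₂ₙ(Q), ω₂ₙ(Q), ψ₂ₙ(Q))`. [folklore] -/
lemma dblXYZ_smulTriple (h : V.toAffine.Equation x₀ y₀) {n : ℤ} (hn : n ≠ 0) :
    Jacobian.dblXYZ V (smulTriple V x₀ y₀ n) = smulTriple V x₀ y₀ (2 * n) := by
  have := Jacobian.map_dblXYZ (W' := UnivEC.curve) (UnivEC.ev V x₀ y₀) (UnivEC.T n)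
  rwa [Jacobian.map, UnivEC.curve_map_ev h, UnivEC.dblXYZ_T hn] at this

/-- The addition identity `addXYZ_T` specialised to `V`. [folklore] -/
lemma addXYZ_smulTriple (h : V.toAffine.Equation x₀ y₀) {n : ℤ} (hn : n ≠ 0) (hn' : n + 1 ≠ 0) :
    Jacobian.addXYZ V (smulTriple V x₀ y₀ n) (smulTriple V x₀ y₀ (n + 1)) =
      smulTriple V x₀ y₀ (2 * n + 1) := by
  have := Jacobian.map_addXYZ (W' := UnivEC.curve) (UnivEC.ev V x₀ y₀) (UnivEC.T n)
    (UnivEC.T (n + 1))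
  rwa [Jacobian.map, UnivEC.curve_map_ev h, UnivEC.addXYZ_T hn hn'] at this

variable [DecidableEq F]

/-- **`(φₙ(Q), ωₙ(Q), ψₙ(Q))` represents `n • Q` in Jacobian coordinates** for every nonsingular
affine point `Q = (x₀, y₀)` of a Weierstrass curve over a field and every `n ≥ 1`. Proof: strong
induction on `n` along `2k = k + k`, `2k + 1 = k + (k + 1)`, using the exact polynomial identities
`dblXYZ_T`, `addXYZ_T` specialised from the universal curve. [cite: SilvermanAEC2009, Exercise 3.7(d)] -/
theorem nonsingular_smulTriple (h : V.toAffine.Nonsingular x₀ y₀) {n : ℕ} (hn : 1 ≤ n) :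
    Jacobian.Nonsingular V (smulTriple V x₀ y₀ n) ∧
      Jacobian.Point.toAffine V (smulTriple V x₀ y₀ n) = (n : ℤ) • Point.some x₀ y₀ h := by
  induction n using Nat.strong_induction_on with
  | _ n ih =>
  rcases Nat.even_or_odd' n with ⟨k, rfl | rfl⟩
  · -- n = 2k, k ≥ 1
    have hk : 1 ≤ k := by omega
    obtain ⟨hns, hto⟩ := ih k (by omega) hk
    have hk0 : (k : ℤ) ≠ 0 := by exact_mod_cast (by omega : k ≠ 0)
    have e : ((2 * k : ℕ) : ℤ) = 2 * (k : ℤ) := by push_cast; ring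
    rw [e, ← dblXYZ_smulTriple h.1 hk0, ← Jacobian.add_self]
    exact ⟨Jacobian.nonsingular_add hns hns,
      by rw [Jacobian.Point.toAffine_add hns hns, hto, ← add_zsmul, two_mul]⟩
  · rcases Nat.eq_zero_or_pos k with rfl | hk
    · -- n = 1
      simp only [mul_zero, zero_add, Nat.cast_one, one_zsmul]
      rw [smulTriple_one 1 rfl]
      exact ⟨(Jacobian.nonsingular_some ..).mpr h,
        Jacobian.Point.toAffine_some ((Jacobian.nonsingular_some ..).mpr h)⟩
    · -- n = 2k + 1, k ≥ 1
      obtain ⟨hns, hto⟩ := ih k (by omega) hk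
      obtain ⟨hns1, hto1⟩ := ih (k + 1) (by omega) (by omega)
      have hk0 : (k : ℤ) ≠ 0 := by exact_mod_cast (by omega : k ≠ 0)
      have hk1 : (k : ℤ) + 1 ≠ 0 := by omega
      have e : ((2 * k + 1 : ℕ) : ℤ) = 2 * (k : ℤ) + 1 := by push_cast; ring
      have e1 : ((k + 1 : ℕ) : ℤ) = (k : ℤ) + 1 := by push_cast; ring
      rw [e1] at hns1 hto1
      have hne : ¬ smulTriple V x₀ y₀ k ≈ smulTriple V x₀ y₀ ((k : ℤ) + 1) := fun heq => by
        have := Jacobian.Point.toAffine_of_equiv (W := V) heq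
        rw [hto, hto1, add_zsmul, one_zsmul, left_eq_add] at this
        exact Point.some_ne_zero _ this
      rw [e, ← addXYZ_smulTriple h.1 hk0 hk1, ← Jacobian.add_of_not_equiv hne]
      exact ⟨Jacobian.nonsingular_add hns hns1,
        by rw [Jacobian.Point.toAffine_add hns hns1, hto, hto1, ← add_zsmul]; congr 1; ring⟩

/-- **Silverman, AEC, Exercise 3.7(f): `ψₙ` vanishes precisely on the nontrivial `n`-torsion.**
For a nonsingular affine point `Q = (x₀, y₀)` of a Weierstrass curve over a field and `n : ℤ`,
`n • Q = O ↔ ψₙ(x₀, y₀) = 0`. [cite: SilvermanAEC2009, Exercise 3.7(f)] -/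
theorem zsmul_some_eq_zero_iff (h : V.toAffine.Nonsingular x₀ y₀) (n : ℤ) :
    n • Point.some x₀ y₀ h = 0 ↔ (V.ψ n).evalEval x₀ y₀ = 0 := by
  -- reduce to `n ≥ 1`
  suffices key : ∀ m : ℕ, 1 ≤ m → ((m : ℤ) • Point.some x₀ y₀ h = 0 ↔ (V.ψ m).evalEval x₀ y₀ = 0) by
    rcases Int.natAbs_eq n with hn | hn <;> rw [hn]
    · rcases Nat.eq_zero_or_pos n.natAbs with h0 | hpos
      · simp [h0]
      · exact key _ hpos
    · rcases Nat.eq_zero_or_pos n.natAbs with h0 | hpos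
      · simp [h0]
      · rw [neg_zsmul, neg_eq_zero, WeierstrassCurve.ψ_neg, evalEval_neg, neg_eq_zero]
        exact key _ hpos
  intro m hm
  obtain ⟨hns, hto⟩ := nonsingular_smulTriple h hm
  have hz : smulTriple V x₀ y₀ m 2 = (V.ψ m).evalEval x₀ y₀ := by
    rw [smulTriple_eq h.1]; rfl
  rw [← hto, ← hz]
  refine ⟨fun h0 => ?_, fun hz0 => Jacobian.Point.toAffine_of_Z_eq_zero hz0⟩
  by_contra hz0
  rw [Jacobian.Point.toAffine_of_Z_ne_zero hns hz0] at h0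
  exact Point.some_ne_zero _ h0

/-- **Silverman, AEC, Exercise 3.7(d): the multiplication-by-`n` map**
`[n]Q = (φₙ(Q)/ψₙ(Q)², ωₙ(Q)/ψₙ(Q)³)` for every nonsingular affine point `Q = (x₀, y₀)` of a
Weierstrass curve over a field and every `n : ℤ` with `ψₙ(Q) ≠ 0` (equivalently `n • Q ≠ O`).
Here `φₙ, ψₙ` are Mathlib's `WeierstrassCurve.φ`, `WeierstrassCurve.ψ` and `ωₙ(Q) = ωEval V x₀ y₀ n`
is the value of the universal `ωₙ`. [cite: SilvermanAEC2009, Exercise 3.7(d)] -/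
theorem zsmul_some_eq_of_evalEval_ψ_ne_zero (h : V.toAffine.Nonsingular x₀ y₀) {n : ℤ}
    (hψ : (V.ψ n).evalEval x₀ y₀ ≠ 0) :
    ∃ hns : V.toAffine.Nonsingular ((V.φ n).evalEval x₀ y₀ / (V.ψ n).evalEval x₀ y₀ ^ 2)
        (ωEval V x₀ y₀ n / (V.ψ n).evalEval x₀ y₀ ^ 3),
      n • Point.some x₀ y₀ h = Point.some _ _ hns := by
  -- the case `n ≥ 1`
  have key : ∀ m : ℕ, 1 ≤ m → (V.ψ m).evalEval x₀ y₀ ≠ 0 →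
      ∃ hns : V.toAffine.Nonsingular ((V.φ m).evalEval x₀ y₀ / (V.ψ m).evalEval x₀ y₀ ^ 2)
        (ωEval V x₀ y₀ m / (V.ψ m).evalEval x₀ y₀ ^ 3),
      (m : ℤ) • Point.some x₀ y₀ h = Point.some _ _ hns := by
    intro m hm hψm
    obtain ⟨hns, hto⟩ := nonsingular_smulTriple h hm
    rw [smulTriple_eq h.1] at hns hto
    have hz : (![(V.φ m).evalEval x₀ y₀, ωEval V x₀ y₀ m, (V.ψ m).evalEval x₀ y₀] : Fin 3 → F) 2 ≠ 0 :=
      hψm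
    rw [Jacobian.Point.toAffine_of_Z_ne_zero hns hz] at hto
    exact ⟨_, hto.symm⟩
  obtain ⟨m, rfl | rfl⟩ := Int.eq_nat_or_neg n
  · have hm : 1 ≤ m := by
      rcases Nat.eq_zero_or_pos m with rfl | hm
      · simp at hψ
      · exact hm
    exact key _ hm hψ
  · -- negative `n`: `(-m) • Q = -(m • Q)` and `ω₋ₘ = ωₘ + a₁φₘψₘ + a₃ψₘ³`
    have hψm : (V.ψ m).evalEval x₀ y₀ ≠ 0 := by
      rw [WeierstrassCurve.ψ_neg, evalEval_neg, neg_ne_zero] at hψ; exact hψ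
    have hmpos : 1 ≤ m := by
      rcases Nat.eq_zero_or_pos m with rfl | hm
      · simp at hψm
      · exact hm
    obtain ⟨hnsm, hm_eq⟩ := key m hmpos hψm
    have hωneg : ωEval V x₀ y₀ (-(m : ℤ)) = ωEval V x₀ y₀ m +
        V.a₁ * (V.φ m).evalEval x₀ y₀ * (V.ψ m).evalEval x₀ y₀ +
          V.a₃ * (V.ψ m).evalEval x₀ y₀ ^ 3 := by
      rw [ωEval, UnivEC.ω_neg, map_add, map_add, map_mul, map_mul, map_mul, map_pow, UnivEC.ev_A₁,
        UnivEC.ev_A₃, UnivEC.map_φ, UnivEC.map_ψ, UnivEC.curve_map_ev h.1, UnivEC.ev_xU,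
        UnivEC.ev_yU, ωEval]
    have ex : (V.φ m).evalEval x₀ y₀ / (V.ψ m).evalEval x₀ y₀ ^ 2 =
        (V.φ (-(m : ℤ))).evalEval x₀ y₀ / (V.ψ (-(m : ℤ))).evalEval x₀ y₀ ^ 2 := by
      rw [WeierstrassCurve.ψ_neg, WeierstrassCurve.φ_neg, evalEval_neg]; ring
    have ey : V.toAffine.negY ((V.φ m).evalEval x₀ y₀ / (V.ψ m).evalEval x₀ y₀ ^ 2)
          (ωEval V x₀ y₀ m / (V.ψ m).evalEval x₀ y₀ ^ 3) =
        ωEval V x₀ y₀ (-(m : ℤ)) / (V.ψ (-(m : ℤ))).evalEval x₀ y₀ ^ 3 := by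
      rw [WeierstrassCurve.ψ_neg, evalEval_neg, hωneg, Affine.negY]
      field_simp
      ring
    obtain ⟨hns', e⟩ := UnivEC.some_eq_some_of_eq (W := V) ex ey
      ((Affine.nonsingular_neg ..).mpr hnsm)
    refine ⟨hns', ?_⟩
    rw [neg_zsmul, hm_eq, Affine.Point.neg_some, e]

/-- The `x`-coordinate of `n • Q` is `φₙ(Q)/ψₙ(Q)²` whenever `n • Q ≠ O`.
[cite: SilvermanAEC2009, Exercise 3.7(d)] -/
theorem zsmul_some_eq_some_φ_div (h : V.toAffine.Nonsingular x₀ y₀) {n : ℤ}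
    (hψ : (V.ψ n).evalEval x₀ y₀ ≠ 0) :
    ∃ y₁ : F, ∃ hns : V.toAffine.Nonsingular ((V.φ n).evalEval x₀ y₀ / (V.ψ n).evalEval x₀ y₀ ^ 2) y₁,
      n • Point.some x₀ y₀ h = Point.some _ _ hns :=
  ⟨_, zsmul_some_eq_of_evalEval_ψ_ne_zero h hψ⟩

end Point

end Affine

/-- **Discharge of the named fact `WeierstrassCurve.zsmul_eq_zero_iff_evalEval_ψ`**
(Silverman, *AEC*, Exercise 3.7(d),(f) in the form vendored by `DivisionPolynomialTorsion`):
for an elliptic curve `V` over a field, an affine point `P = (x, y)` and `n : ℤ`,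
`n • P = 0 ↔ ψₙ(x, y) = 0`. (Ellipticity is not needed.) [cite: SilvermanAEC2009, Exercise 3.7(f)] -/
theorem zsmul_eq_zero_iff_evalEval_ψ_holds {K : Type*} [Field K] [DecidableEq K]
    (V : WeierstrassCurve K) : V.zsmul_eq_zero_iff_evalEval_ψ :=
  fun n _ _ h => Affine.Point.zsmul_some_eq_zero_iff h n

end WeierstrassCurve
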